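import Mathlib
import HarnessLib
import Summits.ValiantsHypothesis.ValiantsHypothesis.Theses.MonotoneRestoration
import Literature.Computability.AlgebraicComplexity.ArithCircuit
import Literature.Computability.AlgebraicComplexity.ArithCircuitProofs
import Literature.Computability.AlgebraicComplexity.MonotoneStructure
import Literature.Computability.AlgebraicComplexity.PermanentIrreducible
import Literature.ModelTheory.FiniteModelTheory.CkEquiv
import Summits.ValiantsHypothesis.ValiantsHypothesis.Theorems.MonotoneRestorationMonotoneRestorationQPCosetCount
import Summits.ValiantsHypothesis.ValiantsHypothesis.Theorems.MonotoneRestorationMonotoneRestorationQPSymmetricLB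
import Summits.ValiantsHypothesis.ValiantsHypothesis.Theorems.MonotoneRestorationMonotoneRestorationQPSupportSymmetrisation
import Summits.ValiantsHypothesis.ValiantsHypothesis.Theorems.MonotoneRestorationMonotoneRestorationQPSparseRegime
import Summits.ValiantsHypothesis.ValiantsHypothesis.Theorems.MonotoneRestorationMonotoneRestorationQPBeta
import Literature.Computability.AlgebraicComplexity.SymmetricArithCircuit
import Literature.Computability.AlgebraicComplexity.DawarWilsenach2025Proofs
import Literature.GroupTheory.PermutationGroups.SmallIndexSubgroups
import Summits.ValiantsHypothesis.ValiantsHypothesis.Theorems.MonotoneRestorationQP.Negative.LoadBearing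
import Summits.ValiantsHypothesis.ValiantsHypothesis.Theorems.MonotoneRestorationMonotoneRestorationQPPermSupportCount

/-! TTRL-lite variant V19943 of stmt-ValiantsHypothesis-15886 -/

set_option linter.dupNamespace false

namespace Summit.ValiantsHypothesis.ValiantsHypothesis.Theorems

open Summit.ValiantsHypothesis.ValiantsHypothesis.Theses.MonotoneRestoration
open Literature.Computability.AlgebraicComplexity

/-- TTRL-lite variant V19943 (small case `c = 0`, so `k = 3`) of the `stub_gammaArithmetic`
arithmetic side conditions: the conjunction of the five size conditions holds exactly when
`23 ≤ n`.  The binding conjunct is `n / 2 + 12 ≤ n`; the binomial bound `2 < n.choose 3`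
follows from `2 < Nat.choose 23 3` and monotonicity of `Nat.choose` in its first argument. -/
theorem stub_gammaArithmetic_var19943 :
    ∀ n : ℕ, (8 < n ∧ 4 * ((Nat.log 2 n + 0) ^ 0 + 2) ≤ n ∧
      ((Nat.log 2 n + 0) ^ 0 + 2) * ((Nat.log 2 n + 0) ^ 0 + 2) ≤ n / 2 ∧
      n / 2 + ((Nat.log 2 n + 0) ^ 0 + 2) + 9 ≤ n ∧
      2 ^ ((Nat.log 2 n + 0) ^ 0) < n.choose ((Nat.log 2 n + 0) ^ 0 + 2)) ↔ 23 ≤ n := by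
  intro n
  simp only [pow_zero, pow_one]
  constructor
  · rintro ⟨-, -, -, h, -⟩
    omega
  · intro h
    refine ⟨by omega, by omega, by omega, by omega, ?_⟩
    calc 2 < Nat.choose 23 3 := by decide
      _ ≤ n.choose 3 := Nat.choose_le_choose 3 h

end Summit.ValiantsHypothesis.ValiantsHypothesis.Theorems
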